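import Mathlib
import Summits.ResolutionOfSingularities.ResolutionOfSingularities.Theorems.HomologicalConductorPersistenceBranchedCoverDescent
import Summits.ResolutionOfSingularities.ResolutionOfSingularities.Theorems.HomologicalConductorPersistenceArenaIdealFormula
import HarnessLib

/-!
# Rung S-2 `PersistenceSurface` (stmt-ResolutionOfSingularities-19970) — DOUBLE POINTS `y² + f = 0`: the
# cohomology annihilator as an explicit ideal, `ca(S[y]/(y² + f)) = (ȳ) + ca(S/(f))·S[y]/(y² + f)`, and the
# `A_{m−1}` curve `y² = zᵐ`: `ca = (ȳ, z̄^⌊m/2⌋)`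

Route `ResolutionOfSingularities/HomologicalConductor`, chain W4.4b (cell res-hironaka; seat
res-L1-w44b-stub-1 gen 5). `[OURS · L1 w44b]` replaces the role of no printed item; NOT a statement of
the manuscript under review (Hironaka 2017), nothing here is attributed to its author; folklore
commutative algebra, AI-written (weaker than expert review).

Stub-2's THEOREM DP (`…PersistenceBranchedCoverDescent`, p547845) gives, for a noetherian `S` with
`f ∈ S⁰`, `2 ∈ Sˣ` and `caᵈ⁺²(S[X]) = ⊤`, the comap form `ca(S[y]/(y² + f)) = π⁻¹(ca(S/(f)))` along
`π : y ↦ 0`, and `ker π = (ȳ)` (`ker_lift_eq`). As for the arenas (`…PersistenceArenaIdealFormula`,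
p562342) this yields an EXPLICIT IDEAL:

* `cohomologyAnnihilator_doublePoint_eq_sup` — `ca(S[y]/(y² + f)) = (ȳ) ⊔ ((ca(S/(f))).comap mk)·S[y]/(y² + f)`
  (any such `S`): the cohomology annihilator of a double point is the root plus the pull-back of the
  cohomology annihilator of the BRANCH LOCUS `S/(f)`;
* `cohomologyAnnihilator_doublePoint_mvPolynomial_eq_sup` — the same over `S = k[z₁,…,z_m]`, `char k ≠ 2`,
  `f ≠ 0`, hypotheses discharged by Hilbert's syzygy theorem (`ArenaDescent.…_eq_top`, `isUnit_two_mvPolynomial`)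
  — so the surface double points `x² = g(y,z)` (`D_n`, `E₆`, `E₇`, `E₈`, `A_r` as `x² − t² = zᵐ`) have
  `ca = (x̄) + ca(k[y,z]/(g))^e`, reducing them to PLANE CURVE cohomology annihilators (= conductors where
  Esentepe's theorem is available: lead-1's ceiling `…ConductorFloor` + stub-2's `…ConductorStable` floor);
* `cohomologyAnnihilator_doublePoint_X_pow_eq` — the `A_{m−1}` PLANE CURVE `k[z][y]/(y² − zᵐ)`:
  **`ca = (ȳ, z̄^⌊m/2⌋)`** for every `m` and `char k ≠ 2` (its conductor: node `𝔪`, cusp `𝔪`, tacnode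
  `(y, z²)`, …), via `ca(k[z]/(zᵐ)) = (z̄^⌊m/2⌋)` (`…TruncatedPrincipalCeiling`, p560390).

References: S. B. Iyengar, R. Takahashi, *Annihilation of cohomology and strong generation of module
categories*, IMRN 2016, arXiv:1404.1476, §2 [`IyengarTakahashi2014`]; Ö. Esentepe, *The cohomology
annihilator of a curve singularity*, J. Algebra 541 (2020), Thm 4.4 / Thm 5.4 (mechanism only)
[`Esentepe2020`].
-/

-- single-problem summit: the doubled namespace component `ResolutionOfSingularities` is forced
set_option linter.dupNamespace false

noncomputable section

open Polynomial Literature.RingTheory.CohomologyAnnihilator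
open Summit.ResolutionOfSingularities.ResolutionOfSingularities.Theorems.HomologicalConductor
open Summit.ResolutionOfSingularities.ResolutionOfSingularities.Theorems.HomologicalConductor.PersistenceArArrivalFloor
open Summit.ResolutionOfSingularities.ResolutionOfSingularities.Theorems.HomologicalConductor.PersistenceTruncatedPrincipalCeiling
open Summit.ResolutionOfSingularities.ResolutionOfSingularities.Theorems.HomologicalConductor.PersistenceArenaIdealFormula
open scoped nonZeroDivisors

universe u

namespace Summit.ResolutionOfSingularities.ResolutionOfSingularities.Theorems.HomologicalConductor.PersistenceDoublePointIdealFormula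

/-! ## §1 The double point over a general base -/

section General

variable {S : Type u} [CommRing S]

/-- `y ↦ 0` kills `y² + f` modulo `f`: the projection `π : S[y]/(y² + f) → S/(f)` is well defined. [folklore] -/
theorem eval₂_X_sq_add_C_eq_zero (f : S) :
    Polynomial.eval₂ (Ideal.Quotient.mk (Ideal.span {f})) (0 : S ⧸ Ideal.span {f}) (X ^ 2 + C f : S[X]) = 0 := by
  rw [eval₂_add, eval₂_X_pow, eval₂_C, zero_pow (by omega), zero_add, Ideal.Quotient.eq_zero_iff_mem]
  exact Ideal.mem_span_singleton_self f

/-- **`ca(S[y]/(y² + f)) = (ȳ) ⊔ ((ca(S/(f))).comap mk)·S[y]/(y² + f)`** for `S` noetherian nontrivial,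
`f ∈ S⁰`, `2 ∈ Sˣ`, `caᵈ⁺²(S[X]) = ⊤`: stub-2's comap form `BranchedCoverDescent.cohomologyAnnihilator_eq_comap`
(`ca = π⁻¹(ca(S/(f)))`), `ker π = (ȳ)` (`BranchedCoverDescent.ker_lift_eq`) and `Ideal.comap_map_of_surjective`
(`π ∘ of = mk` is onto). [cite: IyengarTakahashi2014, Definition 2.1] -/
theorem cohomologyAnnihilator_doublePoint_eq_sup [IsNoetherianRing S] [Nontrivial S] (f : S) (hf : f ∈ S⁰)
    {d : ℕ} (hSX : cohomologyAnnihilatorOfDegree (Polynomial S) (d + 2) = ⊤) (h2 : IsUnit (2 : S)) :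
    cohomologyAnnihilator (AdjoinRoot (X ^ 2 + C f : S[X])) =
      Ideal.span {AdjoinRoot.root (X ^ 2 + C f : S[X])} ⊔
        ((cohomologyAnnihilator (S ⧸ Ideal.span {f})).comap (Ideal.Quotient.mk (Ideal.span {f}))).map
          (AdjoinRoot.of (X ^ 2 + C f : S[X])) := by
  set π : AdjoinRoot (X ^ 2 + C f : S[X]) →+* S ⧸ Ideal.span {f} :=
    AdjoinRoot.lift (Ideal.Quotient.mk (Ideal.span {f})) 0 (eval₂_X_sq_add_C_eq_zero f) with hπ
  set J := (cohomologyAnnihilator (S ⧸ Ideal.span {f})).comap (Ideal.Quotient.mk (Ideal.span {f})) with hJ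
  have hcomp : π.comp (AdjoinRoot.of (X ^ 2 + C f : S[X])) = Ideal.Quotient.mk (Ideal.span {f}) := by
    refine RingHom.ext fun s => ?_
    rw [RingHom.comp_apply, hπ, AdjoinRoot.lift_of]
  have hsurj : Function.Surjective π := fun u => by
    obtain ⟨s, rfl⟩ := Ideal.Quotient.mk_surjective u
    exact ⟨AdjoinRoot.of _ s, by rw [hπ, AdjoinRoot.lift_of]⟩
  have hca : cohomologyAnnihilator (S ⧸ Ideal.span {f}) = (J.map (AdjoinRoot.of (X ^ 2 + C f : S[X]))).map π := by
    rw [Ideal.map_map, hcomp, hJ, Ideal.map_comap_of_surjective _ Ideal.Quotient.mk_surjective]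
  rw [BranchedCoverDescent.cohomologyAnnihilator_eq_comap f hf hSX h2, ← hπ, hca,
    Ideal.comap_map_of_surjective π hsurj, ← RingHom.ker_eq_comap_bot, hπ,
    BranchedCoverDescent.ker_lift_eq f le_rfl, sup_comm]

end General

/-! ## §2 Over a polynomial ring `k[z₁,…,z_m]`, `char k ≠ 2` -/

section MvPolynomial

variable (k : Type u) [Field k]

/-- **`ca(k[z][y]/(y² + f)) = (ȳ) ⊔ ca(k[z]/(f))^e`** for `z = (z₁,…,z_m)`, `char k ≠ 2`, `f ≠ 0` — the
hypotheses of `cohomologyAnnihilator_doublePoint_eq_sup` discharged by Hilbert's syzygy theorem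
(`ArenaDescent.cohomologyAnnihilatorOfDegree_polynomial_mvPolynomial_eq_top`) and `2 ∈ k[z]ˣ`
(`ArenaDescent.isUnit_two_mvPolynomial`). The surface double points `x² = g(y,z)` are the case `m = 2`.
[cite: IyengarTakahashi2014, Definition 2.1] -/
theorem cohomologyAnnihilator_doublePoint_mvPolynomial_eq_sup (h2 : (2 : k) ≠ 0) {m : ℕ}
    (f : MvPolynomial (Fin m) k) (hf : f ≠ 0) :
    cohomologyAnnihilator (AdjoinRoot (X ^ 2 + C f : (MvPolynomial (Fin m) k)[X])) =
      Ideal.span {AdjoinRoot.root (X ^ 2 + C f : (MvPolynomial (Fin m) k)[X])} ⊔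
        ((cohomologyAnnihilator (MvPolynomial (Fin m) k ⧸ Ideal.span {f})).comap
            (Ideal.Quotient.mk (Ideal.span {f}))).map
          (AdjoinRoot.of (X ^ 2 + C f : (MvPolynomial (Fin m) k)[X])) :=
  cohomologyAnnihilator_doublePoint_eq_sup f (mem_nonZeroDivisors_of_ne_zero hf)
    (ArenaDescent.cohomologyAnnihilatorOfDegree_polynomial_mvPolynomial_eq_top k m)
    (ArenaDescent.isUnit_two_mvPolynomial h2 m)

/-- **The `A_{m−1}` PLANE CURVE `y² = zᵐ`: `ca(k[z][y]/(y² − zᵐ)) = (ȳ, z̄^⌊m/2⌋)`** for every `m`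
and every field with `char k ≠ 2` (node: `𝔪`; cusp: `𝔪`; tacnode: `(y, z²)`; …). The branch
locus is `k[z]/(zᵐ)` with `ca = (z̄^⌊m/2⌋)` (`…TruncatedPrincipalCeiling`, p560390), pulled back to
`(z^⌊m/2⌋) ⊆ k[z]` by `ArenaIdealFormula.comap_cohomologyAnnihilator_truncated_eq`.
[cite: IyengarTakahashi2014, Definition 2.1] -/
theorem cohomologyAnnihilator_doublePoint_X_pow_eq (h2 : (2 : k) ≠ 0) (m : ℕ) :
    cohomologyAnnihilator (AdjoinRoot (X ^ 2 + C (-(MvPolynomial.X 0 ^ m)) : (MvPolynomial (Fin 1) k)[X])) =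
      Ideal.span {AdjoinRoot.root (X ^ 2 + C (-(MvPolynomial.X 0 ^ m)) : (MvPolynomial (Fin 1) k)[X]),
        AdjoinRoot.of (X ^ 2 + C (-(MvPolynomial.X 0 ^ m)) : (MvPolynomial (Fin 1) k)[X])
          (MvPolynomial.X 0) ^ (m / 2)} := by
  have hf : (-((MvPolynomial.X 0 : MvPolynomial (Fin 1) k) ^ m)) ≠ 0 :=
    neg_ne_zero.mpr (pow_ne_zero _ (MvPolynomial.X_ne_zero _))
  have hspan : Ideal.span {-((MvPolynomial.X 0 : MvPolynomial (Fin 1) k) ^ m)} =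
      Ideal.span {(MvPolynomial.X 0 : MvPolynomial (Fin 1) k) ^ m} := Ideal.span_singleton_neg _
  rw [cohomologyAnnihilator_doublePoint_mvPolynomial_eq_sup k h2 _ hf]
  -- the branch locus `k[z]/(−zᵐ) = k[z]/(zᵐ)`: its `ca` pulled back to `k[z]` is `(z^⌊m/2⌋)`
  have hJ : (cohomologyAnnihilator (MvPolynomial (Fin 1) k ⧸
      Ideal.span {-((MvPolynomial.X 0 : MvPolynomial (Fin 1) k) ^ m)})).comap
        (Ideal.Quotient.mk (Ideal.span {-((MvPolynomial.X 0 : MvPolynomial (Fin 1) k) ^ m)})) =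
      Ideal.span {(MvPolynomial.X 0 : MvPolynomial (Fin 1) k) ^ (m / 2)} := by
    have h := comap_cohomologyAnnihilator_truncated_eq k m
    rw [← hspan] at h
    exact h
  rw [hJ, Ideal.map_span, Set.image_singleton, map_pow, ← Ideal.span_union, Set.singleton_union]

end MvPolynomial

end Summit.ResolutionOfSingularities.ResolutionOfSingularities.Theorems.HomologicalConductor.PersistenceDoublePointIdealFormula

end
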